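import Summits.CriticalPhenomena.PercolationContinuityZ3.Theorems.PercNearOneGluingNoHeavyConstsClusterSquareWheel
import Summits.CriticalPhenomena.PercolationContinuityZ3.Theorems.PercNearOneGluingNoHeavyConstsClusterSquareQuadClashBoundary
import HarnessLib

/-!
# Partial wheels II: the hub as a terminal — TS for EVERY triple of a weighted partial wheel

builds on p205010 (kernel theorem, internal audit signed; external expert review pending)

PAPER-2 track "percolation constants", part (ii), seat `prim-consts-1`, gen 19 (lane index
`run/shared/lean/prim/consts/CONSTANTS.md`, row A19; memo `FROM-prim-consts-1-g19-ROOT-CHOICE.md` §0(8)).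
Support file for the crux `NoHeavyLowerTail` (stmt-CriticalPhenomena-4575; `--supports`).  Theorems only; no sorries.

`…ConstsClusterSquareWheel.lean` proves CSQ/DUU/TS on a partial wheel (hub `h`, rim positions `pos`, rim–rim edges between cyclically
consecutive positions only, hub–rim edges arbitrary) when all three terminals lie on the rim.  When the HUB is a terminal, no cluster of a
rim root `r` avoiding the hub can have four distinct outside neighbours: such a cluster is a cyclic interval of the rim
(`Consts.Wheel.not_between_of_mem`), so its outside neighbours are the hub and at most two rim vertices (`Consts.Wheel.three_rim_false`,
`Consts.Wheel.no_four_neighbours`).  Gen 18's boundary criterion `Consts.tripleSplit_of_boundary_le_three` (no quadruple clash) then gives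
CSQ/DUU at the rim root and TS (`Consts.clusterSquare_le_sq_of_wheel_hub`, `Consts.sq_real_split_le_of_wheel_hub`,
`Consts.tripleSplit_of_wheel_hub`); with `Consts.tripleSplit_of_wheel` this is **TS for every triple of terminals of every weighted partial
wheel** (concrete form `Consts.tripleSplit_wheel_hub` on `Fin (N+1)` with hub `Fin.last N`, companion of `Consts.tripleSplit_wheel`).
References: N. Gladkov, arXiv:2408.08457v2 (2024), Thm. 4.3, Def. 4.2, Lemma 3.1, Thm. 5.2.
-/

noncomputable section

open Classical

namespace Summit.CriticalPhenomena.PercolationContinuityZ3.Theorems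

open MeasureTheory Finset Literature.Probability.LatticeModels Literature.Probability.Percolation

namespace Consts

namespace Wheel

variable {n m : ℕ} {H : SimpleGraph (Fin n)} {h : Fin n} {pos : Fin n → Fin m}

/-- The middle one of three rim vertices outside a cyclic interval `K` cannot have a `K`-neighbour at distance one. [folklore] -/
private theorem arith_mid {U₁ U₂ U₃ K₂ m : ℕ} (h12 : U₁ < U₂) (h23 : U₂ < U₃) (l3 : U₃ < m)
    (s : U₂ = K₂ + 1 ∨ K₂ = U₂ + 1 ∨ (K₂ + 1 = m ∧ U₂ = 0) ∨ (U₂ + 1 = m ∧ K₂ = 0))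
    (n1 : ¬ (U₂ < K₂ ∧ K₂ < U₃)) (n2 : ¬ (U₁ < K₂ ∧ K₂ < U₂)) (d1 : K₂ ≠ U₁) (d3 : K₂ ≠ U₃) : False := by
  omega

/-- Three distinct rim vertices outside a hub-free `K` (connected from `r ∈ K`) cannot all have neighbours in `K`. [folklore] -/
theorem three_rim_false (hpos : ∀ u v, u ≠ h → v ≠ h → pos u = pos v → u = v)
    (hrim : ∀ u v, u ≠ h → v ≠ h → H.Adj u v → (pos v - pos u).val = 1 ∨ (pos u - pos v).val = 1)
    {K : Set (Fin n)} {r : Fin n} (hhK : h ∉ K) (hKw : ∀ s ∈ K, ∃ W : H.Walk r s, ∀ v ∈ W.support, v ∈ K)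
    {u₁ u₂ u₃ : Fin n} (h₁ : u₁ ∉ K) (h₂ : u₂ ∉ K) (h₃ : u₃ ∉ K) (h₁h : u₁ ≠ h) (h₂h : u₂ ≠ h) (h₃h : u₃ ≠ h)
    (d₁₂ : u₁ ≠ u₂) (d₁₃ : u₁ ≠ u₃) (d₂₃ : u₂ ≠ u₃)
    (hk₁ : ∃ k, k ∈ K ∧ H.Adj k u₁) (hk₂ : ∃ k, k ∈ K ∧ H.Adj k u₂) (hk₃ : ∃ k, k ∈ K ∧ H.Adj k u₃) : False := by
  obtain ⟨k₁, hk₁K, hk₁u⟩ := hk₁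
  obtain ⟨k₂, hk₂K, hk₂u⟩ := hk₂
  obtain ⟨k₃, hk₃K, hk₃u⟩ := hk₃
  have hk₁h : k₁ ≠ h := fun e => hhK (e ▸ hk₁K)
  have hk₂h : k₂ ≠ h := fun e => hhK (e ▸ hk₂K)
  have hk₃h : k₃ ≠ h := fun e => hhK (e ▸ hk₃K)
  have D : ∀ {u v : Fin n}, u ≠ h → v ≠ h → u ≠ v → (pos u - pos r).val ≠ (pos v - pos r).val :=
    fun hu hv huv e => huv (hpos _ _ hu hv (NonCrossing.rot_injective (pos r) e))
  have d12 := D h₁h h₂h d₁₂; have d13 := D h₁h h₃h d₁₃; have d23 := D h₂h h₃h d₂₃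
  have e11 := D hk₁h h₁h (fun e => h₁ (e ▸ hk₁K)); have e12 := D hk₁h h₂h (fun e => h₂ (e ▸ hk₁K))
  have e13 := D hk₁h h₃h (fun e => h₃ (e ▸ hk₁K))
  have e21 := D hk₂h h₁h (fun e => h₁ (e ▸ hk₂K)); have e22 := D hk₂h h₂h (fun e => h₂ (e ▸ hk₂K))
  have e23 := D hk₂h h₃h (fun e => h₃ (e ▸ hk₂K))
  have e31 := D hk₃h h₁h (fun e => h₁ (e ▸ hk₃K)); have e32 := D hk₃h h₂h (fun e => h₂ (e ▸ hk₃K))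
  have e33 := D hk₃h h₃h (fun e => h₃ (e ▸ hk₃K))
  have l1 := (pos u₁ - pos r).isLt; have l2 := (pos u₂ - pos r).isLt; have l3 := (pos u₃ - pos r).isLt
  have s1 := step hrim r hk₁h h₁h hk₁u
  have s2 := step hrim r hk₂h h₂h hk₂u
  have s3 := step hrim r hk₃h h₃h hk₃u
  have n12 := not_between_of_mem hpos hrim hhK hKw h₁ h₂ h₁h h₂h hk₁K
  have n13 := not_between_of_mem hpos hrim hhK hKw h₁ h₃ h₁h h₃h hk₁K
  have n12' := not_between_of_mem hpos hrim hhK hKw h₂ h₁ h₂h h₁h hk₁K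
  have n13' := not_between_of_mem hpos hrim hhK hKw h₃ h₁ h₃h h₁h hk₁K
  have p12 := not_between_of_mem hpos hrim hhK hKw h₁ h₂ h₁h h₂h hk₂K
  have p21 := not_between_of_mem hpos hrim hhK hKw h₂ h₁ h₂h h₁h hk₂K
  have p23 := not_between_of_mem hpos hrim hhK hKw h₂ h₃ h₂h h₃h hk₂K
  have p32 := not_between_of_mem hpos hrim hhK hKw h₃ h₂ h₃h h₂h hk₂K
  have q13 := not_between_of_mem hpos hrim hhK hKw h₁ h₃ h₁h h₃h hk₃K
  have q31 := not_between_of_mem hpos hrim hhK hKw h₃ h₁ h₃h h₁h hk₃K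
  have q23 := not_between_of_mem hpos hrim hhK hKw h₂ h₃ h₂h h₃h hk₃K
  have q32 := not_between_of_mem hpos hrim hhK hKw h₃ h₂ h₃h h₂h hk₃K
  -- which of the three is in the middle
  rcases Nat.lt_or_gt_of_ne d12 with a12 | a21 <;> rcases Nat.lt_or_gt_of_ne d23 with a23 | a32 <;>
    rcases Nat.lt_or_gt_of_ne d13 with a13 | a31
  · exact arith_mid a12 a23 l3 s2 p23 p12 e21 e23            -- u₁ < u₂ < u₃
  · omega
  · exact arith_mid a13 a32 l2 s3 q32 q13 e31 e32            -- u₁ < u₃ < u₂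
  · exact arith_mid a31 a12 l2 s1 n12 n13' e13 e12           -- u₃ < u₁ < u₂
  · exact arith_mid a21 a13 l3 s1 n13 n12' e12 e13           -- u₂ < u₁ < u₃
  · exact arith_mid a23 a31 l1 s3 q31 q23 e32 e31            -- u₂ < u₃ < u₁
  · omega
  · exact arith_mid a32 a21 l1 s2 p21 p32 e23 e21            -- u₃ < u₂ < u₁

/-- **A hub-free cluster of a rim vertex has at most three outside neighbours** (the hub and the two rim vertices next to the interval):
the hypothesis `hK` of `Consts.tripleSplit_of_boundary_le_three` at a rim root `r` when the hub is one of the other two terminals.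
[folklore] -/
theorem no_four_neighbours (H : SimpleGraph (Fin n)) (h : Fin n) (pos : Fin n → Fin m)
    (hpos : ∀ u v, u ≠ h → v ≠ h → pos u = pos v → u = v)
    (hrim : ∀ u v, u ≠ h → v ≠ h → H.Adj u v → (pos v - pos u).val = 1 ∨ (pos u - pos v).val = 1)
    (r s t : Fin n) (hst : s = h ∨ t = h) :
    ∀ (K : Set (Fin n)) (v₁ v₂ v₃ v₄ : Fin n), r ∈ K → s ∉ K → t ∉ K →
      (∀ T : Set (Fin n), r ∈ T → (∀ u x, u ∈ T → H.Adj u x → x ∈ K → x ∈ T) → K ⊆ T) →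
      v₁ ∉ K → v₂ ∉ K → v₃ ∉ K → v₄ ∉ K →
      (∃ k, k ∈ K ∧ H.Adj k v₁) → (∃ k, k ∈ K ∧ H.Adj k v₂) → (∃ k, k ∈ K ∧ H.Adj k v₃) → (∃ k, k ∈ K ∧ H.Adj k v₄) →
      v₁ ≠ v₂ → v₁ ≠ v₃ → v₁ ≠ v₄ → v₂ ≠ v₃ → v₂ ≠ v₄ → v₃ ≠ v₄ → False := by
  intro K v₁ v₂ v₃ v₄ hrK hsK htK hcl h₁ h₂ h₃ h₄ hk₁ hk₂ hk₃ hk₄ d₁₂ d₁₃ d₁₄ d₂₃ d₂₄ d₃₄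
  have hhK : h ∉ K := by rcases hst with rfl | rfl <;> assumption
  have hKw := NonCrossing.walks_of_closure hrK hcl
  by_cases e₁ : v₁ = h
  · subst e₁
    exact three_rim_false hpos hrim hhK hKw h₂ h₃ h₄ (Ne.symm d₁₂) (Ne.symm d₁₃) (Ne.symm d₁₄) d₂₃ d₂₄ d₃₄ hk₂ hk₃ hk₄
  by_cases e₂ : v₂ = h
  · subst e₂
    exact three_rim_false hpos hrim hhK hKw h₁ h₃ h₄ e₁ (Ne.symm d₂₃) (Ne.symm d₂₄) d₁₃ d₁₄ d₃₄ hk₁ hk₃ hk₄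
  by_cases e₃ : v₃ = h
  · subst e₃
    exact three_rim_false hpos hrim hhK hKw h₁ h₂ h₄ e₁ e₂ (Ne.symm d₃₄) d₁₂ d₁₄ d₂₄ hk₁ hk₂ hk₄
  · exact three_rim_false hpos hrim hhK hKw h₁ h₂ h₃ e₁ e₂ e₃ d₁₂ d₁₃ d₂₃ hk₁ hk₂ hk₃

end Wheel

/-! ### CSQ, DUU, TS with the hub as a terminal -/

section Fin

variable {n m : ℕ} (w : Sym2 (Fin n) → unitInterval) (r s t : Fin n) (H : SimpleGraph (Fin n)) (h : Fin n)
  (pos : Fin n → Fin m)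

/-- **CSQ at a rim root of a partial wheel when the hub is one of the other terminals.**
[cite: Gladkov2024, Thm. 4.3, Def. 4.2, Lemma 3.1, Thm. 5.2] -/
theorem clusterSquare_le_sq_of_wheel_hub (hH : ∀ u v, u ≠ v → (0 : ℝ) < w s(u, v) → H.Adj u v)
    (hpos : ∀ u v, u ≠ h → v ≠ h → pos u = pos v → u = v)
    (hrim : ∀ u v, u ≠ h → v ≠ h → H.Adj u v → (pos v - pos u).val = 1 ∨ (pos u - pos v).val = 1)
    (hst : s = h ∨ t = h) :
    clusterSquare w r s t ≤ (prodBernoulli w).real (openConn s t)ᶜ ^ 2 :=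
  clusterSquare_le_sq_of_boundary_le_three w r s t H hH (Wheel.no_four_neighbours H h pos hpos hrim r s t hst)

/-- **DUU at a rim root of a partial wheel when the hub is one of the other terminals.** [cite: Gladkov2024, Thm. 5.2 and Thm. 4.3] -/
theorem sq_real_split_le_of_wheel_hub (hH : ∀ u v, u ≠ v → (0 : ℝ) < w s(u, v) → H.Adj u v)
    (hpos : ∀ u v, u ≠ h → v ≠ h → pos u = pos v → u = v)
    (hrim : ∀ u v, u ≠ h → v ≠ h → H.Adj u v → (pos v - pos u).val = 1 ∨ (pos u - pos v).val = 1)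
    (hst : s = h ∨ t = h) :
    (prodBernoulli w).real ((openConn r s)ᶜ ∩ (openConn r t)ᶜ ∩ (openConn s t)ᶜ) ^ 2 ≤
      (prodBernoulli w).real ((openConn r s)ᶜ ∩ (openConn r t)ᶜ) * (prodBernoulli w).real (openConn s t)ᶜ ^ 2 :=
  sq_real_split_le_of_boundary_le_three w r s t H hH (Wheel.no_four_neighbours H h pos hpos hrim r s t hst)

/-- **TS on a partial wheel with the hub among the terminals** (rooted at the rim terminal `r`):
`μ(r↮s, r↮t, s↮t)² ≤ μ(r↮s) μ(r↮t) μ(s↮t)`. [cite: Gladkov2024, Thm. 5.2, Cor. 5.3 (pattern) and Thm. 4.3] -/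
theorem tripleSplit_of_wheel_hub (hH : ∀ u v, u ≠ v → (0 : ℝ) < w s(u, v) → H.Adj u v)
    (hpos : ∀ u v, u ≠ h → v ≠ h → pos u = pos v → u = v)
    (hrim : ∀ u v, u ≠ h → v ≠ h → H.Adj u v → (pos v - pos u).val = 1 ∨ (pos u - pos v).val = 1)
    (hst : s = h ∨ t = h) :
    (prodBernoulli w).real ((openConn r s)ᶜ ∩ (openConn r t)ᶜ ∩ (openConn s t)ᶜ) ^ 2 ≤
      (prodBernoulli w).real (openConn r s)ᶜ * (prodBernoulli w).real (openConn r t)ᶜ *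
        (prodBernoulli w).real (openConn s t)ᶜ :=
  tripleSplit_of_boundary_le_three w r s t H hH (Wheel.no_four_neighbours H h pos hpos hrim r s t hst)

/-- **TS on the (partial) wheel with the hub as a terminal, concretely** (companion of `Consts.tripleSplit_wheel`): vertices `Fin (N+1)`,
hub `Fin.last N`, any `w` whose positive rim–rim pairs are cyclically consecutive; TS for the hub and any two rim vertices
`a.castSucc, b.castSucc` (rooted at `a.castSucc`). [cite: Gladkov2024, Thm. 5.2, Cor. 5.3 (pattern) and Thm. 4.3] -/
theorem tripleSplit_wheel_hub (N : ℕ) (w : Sym2 (Fin (N + 1)) → unitInterval)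
    (hw : ∀ i j : Fin N, i ≠ j → (0 : ℝ) < w s(i.castSucc, j.castSucc) → (j - i).val = 1 ∨ (i - j).val = 1)
    (a b : Fin N) :
    (prodBernoulli w).real ((openConn a.castSucc (Fin.last N))ᶜ ∩ (openConn a.castSucc b.castSucc)ᶜ ∩
        (openConn (Fin.last N) b.castSucc)ᶜ) ^ 2 ≤
      (prodBernoulli w).real (openConn a.castSucc (Fin.last N))ᶜ * (prodBernoulli w).real (openConn a.castSucc b.castSucc)ᶜ *
        (prodBernoulli w).real (openConn (Fin.last N) b.castSucc)ᶜ := by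
  have hH : ∀ u v : Fin (N + 1), u ≠ v → (0 : ℝ) < w s(u, v) →
      (SimpleGraph.fromRel fun u v : Fin (N + 1) => (0 : ℝ) < w s(u, v)).Adj u v := fun u v huv h => by
    rw [SimpleGraph.fromRel_adj]; exact ⟨huv, Or.inl h⟩
  refine tripleSplit_of_wheel_hub w a.castSucc (Fin.last N) b.castSucc
    (SimpleGraph.fromRel fun u v : Fin (N + 1) => (0 : ℝ) < w s(u, v)) (Fin.last N)
    (fun u => if hu : u = Fin.last N then a else u.castPred hu) hH ?_ ?_ (Or.inl rfl)
  · intro u v hu hv huv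
    simp only [hu, hv, dite_false] at huv
    exact Fin.castPred_inj.1 huv
  · intro u v hu hv hadj
    rw [SimpleGraph.fromRel_adj] at hadj
    obtain ⟨hne, hp⟩ := hadj
    have hp' : (0 : ℝ) < w s(u, v) := by
      rcases hp with h | h
      · exact h
      · rwa [Sym2.eq_swap]
    obtain ⟨i, rfl⟩ := Fin.exists_castSucc_eq.2 hu
    obtain ⟨j, rfl⟩ := Fin.exists_castSucc_eq.2 hv
    have hij : i ≠ j := fun e => hne (e ▸ rfl)
    simp only [hu, hv, dite_false, Fin.castPred_castSucc]
    exact hw i j hij hp'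

end Fin

end Consts

end Summit.CriticalPhenomena.PercolationContinuityZ3.Theorems
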